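import Literature.NumberTheory.Sieve.MontgomeryVaughan1975GaussSums
import Literature.NumberTheory.Sieve.FriedlanderIwaniecPrimesGcdSums
import Literature.NumberTheory.QuadraticFields.JacobiCharacterPrimitiveProofs
import Literature.NumberTheory.QuadraticFields.KroneckerCharacterFourProofs
import HarnessLib

/-!
# Friedlander–Iwaniec, *The polynomial `X² + Y⁴` captures its primes*, §11: Lemmas 11.2 and 11.3 (Jacobi-twisted sums, the easy lemmas)

Family `parity`, statement parity.S17 (`setOf_prime_sq_add_pow_four_infinite`). Source: J. Friedlander,
H. Iwaniec, Ann. of Math. (2) 148 (1998), 945–1040 [FriedlanderIwaniecAnnals1998], §11 "Jacobi-twisted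
sums over arithmetic progressions", pp. 987–989: Lemma 11.2 (11.15), Lemma 11.3 (11.16).

Sections 11–14 of the source ("These four sections can be more or less considered as an independent
unit") estimate the variance `V(D)` (11.11) of the twisted sums `∑_{r̄ s ≡ a (d)} α_{rs} (r / d')`
over moduli `D < d ≤ 2D`; the end product, Proposition 14.1, is what §15 (Proposition 15.1) feeds
into the bound for `V(β)`, one of the three parts `T(β) = U(β) + V(β) + W(β)` (10.14) of the main
term of Proposition 4.1 (`FriedlanderIwaniec1998_prop41`, §§4–26 of the source). This file opens
that unit with the two counting/character-sum lemmas that precede Proposition 11.1; everything is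
PROVED, there are no definitions and no named facts. Planned sequels of this unit: Lemma 11.4
(`…JacobiTwistedLemma114`), Proposition 11.1 (the basic estimate (11.14) via the dual form (11.18)),
then §§12–14.

* **Lemma 11.2** (`card_congrPairs_le`, one-sided form `card_congrPairs_le_add_left`, printed form
  `card_congrPairs_le_sqrt`): for `(a, b, d) = 1` the number of solutions of `a r ≡ b s (mod d)` in
  `1 ≤ r ≤ R`, `1 ≤ s ≤ S` is at most `RS/d + min(R, S) ≤ RS/d + √(RS)` ("Dividing the congruence
  by `α = (a, d)` and `β = (b, d)`, then counting the solutions in two ways").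
* **Lemma 11.3** (`sum_sq_coprime_jacobiSym_le_min`; the two bounds separately:
  `sum_sq_coprime_jacobiSym_le_first`, `sum_sq_coprime_jacobiSym_le_second`): for `e ≥ 1`,
  `∑_{q ≤ Q, q' ≠ □} |∑_{r ≤ R, (r,e)=1} (r / q')|² ≤ C min{τ(e)² Q², QR + R³} ((1+log Q)(1+log R))^κ`,
  `q'` the odd part of `q` (`ordCompl[2] q`), `(r / q')` the Jacobi symbol. As printed the factor is
  `(log QR)²`; here `C, κ` are absolute (unspecified) constants — downstream (Lemma 11.4, (11.17))
  only the shape `min{τ(e)² Q², QR + R³} (QR)^ε` matters. The first bound is Pólya–Vinogradov in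
  `r` (the character `(· / q')` mod `q'` is non-principal for `q'` a non-square, but imprimitive when
  `q'` is not squarefree, which costs a factor `τ(q')`); the second is "square out and change the
  order of summation": pairs `r₁ r₂ = □` are at most `∑_{t ≤ R} τ(t)²` in number
  (`card_filter_isSquare_mul_le`), and for `r₁ r₂ ≠ □` the sum over `q` of `(r₁ r₂ / q')`, grouped by
  the power of `2` in `q` (`sum_Icc_ordCompl_two_eq`), is a sum of `log₂ Q + 1` interval sums of the
  Kronecker character `n ↦ (r₁ r₂ / n)` modulo `4 r₁ r₂` (`abs_sum_jacobiSym_ordCompl_le`).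

Tools proved on the way (reusable in the sequels):
* `sum_Ioc_filter_coprime_eq`, `norm_sum_Ioc_filter_coprime_le` — removing `(n, e) = 1` from a
  character sum by Möbius inversion, at the cost of a factor `τ(e)`;
* `apply_natCast_eq_ite_primitiveCharacter` — `χ(n) = [(n,k)=1] χ*(n)` with `χ*` the primitive
  character inducing `χ`; **`norm_sum_Ioc_le_of_ne_one`** — Pólya–Vinogradov for every
  non-principal character mod `k`: `|∑_{A<n≤B} χ(n)| ≤ τ(k) √k (1 + log k)` (from the primitive case
  `LargeSieve.polyaVinogradov` of the tree);
* `exists_prime_odd_pow_mul_of_not_isSquare`, `exists_odd_jacobiSym_eq_neg_one` (an odd `m` with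
  `(a / m) = −1` for `a` a positive non-square, by reciprocity and the Chinese remainder theorem),
  `ne_one_of_forall_odd_eq_jacobiSym` (the Kronecker character of a non-square is non-principal),
  `jacobiChar_ne_one_of_not_isSquare` (so is `(· / q)` for `q` odd non-square);
* `card_le_div_add_one_of_dvd_sub`, `card_filter_product_eq_sum`, `card_Icc_filter_dvd`,
  `filter_dvd_Ioc_eq_image`, `natLog_two_add_one_le`, `sigma_zero_four`.

## References

* J. Friedlander, H. Iwaniec, *The polynomial `X² + Y⁴` captures its primes*, Ann. of Math. (2)
  148 (1998), 945–1040, §11, Lemmas 11.2–11.3, (11.15)–(11.16). [FriedlanderIwaniecAnnals1998]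
* G. Pólya (1918), I. Schur (1918); A. C. Cojocaru, M. R. Murty, *An introduction to sieve methods
  and their applications*, CUP 2005, (8.14) (the primitive case, as vendored in the tree).
  [CojocaruMurty2005]

## Tree / Mathlib

Tree: `LargeSieve.polyaVinogradov` (`LargeSieveCharacters`); `MontgomeryVaughan1975.coprime_indicator_eq_sum_moebius`
(`MontgomeryVaughan1975GaussSums`); `QuadraticFields.jacobiChar`,
`jacobiChar_natCast` (`JacobiCharacter`); `QuadraticFields.exists_dirichletCharacter_four_mul`
(`KroneckerCharacterFourProofs`); `exists_sum_tau_pow_le_one` (`FriedlanderIwaniecPrimesGcdSums`),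
`sigma_zero_mul_le`, `sigma_zero_le_of_dvd` (`DivisorPowerSums`). Mathlib: `jacobiSym.mod_right'`,
`jacobiSym.quadratic_reciprocity_one_mod_four(')`, `jacobiSym.at_two`, `jacobiSym.mul_right'`,
`DirichletCharacter.primitiveCharacter`, `FactorsThrough.eq_changeLevel`,
`DirichletCharacter.eq_one_iff_conductor_eq_one`, `FiniteField.exists_nonsquare`,
`Nat.chineseRemainder`, `Nat.sq_mul_squarefree_of_pos`, `Nat.ordProj_mul_ordCompl_eq_self`,
`Nat.Ioc_filter_dvd_card_eq_div`.
-/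

noncomputable section

open Finset Real
open scoped NumberTheorySymbols ArithmeticFunction.Moebius ArithmeticFunction.sigma Nat

namespace Literature.NumberTheory.Sieve.FriedlanderIwaniecPrimes

/-! ### Möbius removal of a coprimality condition -/

/-- The indicator of `(n, e) = 1` by Möbius inversion over the divisors of `e ≠ 0`:
`[(n, e) = 1] = ∑_{g ∣ e, g ∣ n} μ(g)` (the tree's `MontgomeryVaughan1975.coprime_indicator_eq_sum_moebius`
sums over the divisors of `gcd(n, e)`). [folklore] -/
theorem ite_coprime_eq_sum_filter_moebius (n : ℕ) {e : ℕ} (he : e ≠ 0) :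
    (if n.Coprime e then (1 : ℂ) else 0) = ∑ g ∈ e.divisors.filter (· ∣ n), (μ g : ℂ) := by
  rw [MontgomeryVaughan1975.coprime_indicator_eq_sum_moebius n e]
  refine sum_congr ?_ fun _ _ => rfl
  ext g
  simp only [Nat.mem_divisors, mem_filter, Nat.dvd_gcd_iff, ne_eq, Nat.gcd_eq_zero_iff, not_and]
  tauto

/-- The multiples of `g ≥ 1` in `(A, B]` are the `g t` with `t ∈ (A/g, B/g]`. [folklore] -/
theorem filter_dvd_Ioc_eq_image {g : ℕ} (hg : 0 < g) (A B : ℕ) :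
    (Ioc A B).filter (fun n => g ∣ n) = (Ioc (A / g) (B / g)).image (fun t => g * t) := by
  ext n
  simp only [mem_filter, mem_Ioc, mem_image]
  constructor
  · rintro ⟨⟨h1, h2⟩, ⟨t, rfl⟩⟩
    refine ⟨t, ⟨?_, ?_⟩, rfl⟩
    · exact Nat.div_lt_of_lt_mul (by linarith [Nat.mul_comm g t])
    · exact (Nat.le_div_iff_mul_le hg).mpr (by linarith [Nat.mul_comm g t])
  · rintro ⟨t, ⟨h1, h2⟩, rfl⟩
    refine ⟨⟨?_, ?_⟩, dvd_mul_right g t⟩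
    · have := Nat.lt_mul_of_div_lt h1 hg
      linarith [Nat.mul_comm g t]
    · have := (Nat.le_div_iff_mul_le hg).mp h2
      linarith [Nat.mul_comm g t]

/-- **Removing a coprimality condition by Möbius inversion.** For `f` completely multiplicative
on `ℕ` and `e ≠ 0`:
`∑_{A < n ≤ B, (n, e) = 1} f(n) = ∑_{g ∣ e} μ(g) f(g) ∑_{A/g < t ≤ B/g} f(t)`. [folklore] -/
theorem sum_Ioc_filter_coprime_eq {f : ℕ → ℂ} (hf : ∀ m n, f (m * n) = f m * f n) {e : ℕ}
    (he : e ≠ 0) (A B : ℕ) :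
    ∑ n ∈ (Ioc A B).filter (fun n => n.Coprime e), f n =
      ∑ g ∈ e.divisors, (μ g : ℂ) * f g * ∑ t ∈ Ioc (A / g) (B / g), f t := by
  calc ∑ n ∈ (Ioc A B).filter (fun n => n.Coprime e), f n
      = ∑ n ∈ Ioc A B, (if n.Coprime e then (1 : ℂ) else 0) * f n := by
        rw [sum_filter]
        refine sum_congr rfl fun n _ => ?_
        split_ifs <;> simp
    _ = ∑ n ∈ Ioc A B, ∑ g ∈ e.divisors.filter (· ∣ n), (μ g : ℂ) * f n := by
        refine sum_congr rfl fun n _ => ?_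
        rw [ite_coprime_eq_sum_filter_moebius n he, sum_mul]
    _ = ∑ n ∈ Ioc A B, ∑ g ∈ e.divisors, if g ∣ n then (μ g : ℂ) * f n else 0 := by
        refine sum_congr rfl fun n _ => ?_
        rw [sum_filter]
    _ = ∑ g ∈ e.divisors, ∑ n ∈ Ioc A B, if g ∣ n then (μ g : ℂ) * f n else 0 := sum_comm
    _ = ∑ g ∈ e.divisors, (μ g : ℂ) * ∑ n ∈ (Ioc A B).filter (fun n => g ∣ n), f n := by
        refine sum_congr rfl fun g _ => ?_
        rw [sum_filter, mul_sum]
        refine sum_congr rfl fun n _ => ?_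
        split_ifs <;> simp
    _ = ∑ g ∈ e.divisors, (μ g : ℂ) * f g * ∑ t ∈ Ioc (A / g) (B / g), f t := by
        refine sum_congr rfl fun g hg => ?_
        have hg0 : 0 < g := Nat.pos_of_mem_divisors hg
        rw [filter_dvd_Ioc_eq_image hg0,
          sum_image (fun x _ y _ h => Nat.eq_of_mul_eq_mul_left hg0 h)]
        have h2 : ∑ x ∈ Ioc (A / g) (B / g), f (g * x) = ∑ t ∈ Ioc (A / g) (B / g), f g * f t :=
          sum_congr rfl fun t _ => hf g t
        rw [h2, ← mul_sum, mul_assoc]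

/-- The bound that goes with `sum_Ioc_filter_coprime_eq`: if `|f| ≤ 1` and every interval sum of
`f` is at most `M`, then every interval sum of `f` restricted to `(n, e) = 1` is at most `τ(e) M`.
[folklore] -/
theorem norm_sum_Ioc_filter_coprime_le {f : ℕ → ℂ} (hf : ∀ m n, f (m * n) = f m * f n)
    (hf1 : ∀ n, ‖f n‖ ≤ 1) {M : ℝ} (hM : ∀ A B, ‖∑ t ∈ Ioc A B, f t‖ ≤ M) {e : ℕ} (he : e ≠ 0)
    (A B : ℕ) :
    ‖∑ n ∈ (Ioc A B).filter (fun n => n.Coprime e), f n‖ ≤ (σ 0 e : ℝ) * M := by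
  rw [sum_Ioc_filter_coprime_eq hf he]
  have hM0 : 0 ≤ M := (norm_nonneg _).trans (hM 0 0)
  calc ‖∑ g ∈ e.divisors, (μ g : ℂ) * f g * ∑ t ∈ Ioc (A / g) (B / g), f t‖
      ≤ ∑ g ∈ e.divisors, ‖(μ g : ℂ) * f g * ∑ t ∈ Ioc (A / g) (B / g), f t‖ := norm_sum_le _ _
    _ ≤ ∑ g ∈ e.divisors, M := by
        refine sum_le_sum fun g _ => ?_
        rw [norm_mul, norm_mul]
        have hμ : ‖(μ g : ℂ)‖ ≤ 1 := by
          rw [Complex.norm_intCast]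
          exact_mod_cast ArithmeticFunction.abs_moebius_le_one
        calc ‖(μ g : ℂ)‖ * ‖f g‖ * ‖∑ t ∈ Ioc (A / g) (B / g), f t‖ ≤ 1 * 1 * M :=
              mul_le_mul (mul_le_mul hμ (hf1 g) (norm_nonneg _) zero_le_one) (hM _ _)
                (norm_nonneg _) (by positivity)
          _ = M := by ring
    _ = (σ 0 e : ℝ) * M := by
        rw [sum_const, nsmul_eq_mul, ArithmeticFunction.sigma_zero_apply]

/-! ### The Pólya–Vinogradov inequality for non-principal characters -/

/-- Mathlib's `primitiveCharacter` is the factor `χ₀` through the conductor (definitional).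
[folklore] -/
theorem primitiveCharacter_eq_χ₀ {k : ℕ} (χ : DirichletCharacter ℂ k) :
    χ.primitiveCharacter = (DirichletCharacter.factorsThrough_conductor χ).χ₀ := rfl

/-- The values of a Dirichlet character at naturals through its primitive character:
`χ(n) = χ*(n)` if `(n, k) = 1` and `χ(n) = 0` otherwise. [folklore] -/
theorem apply_natCast_eq_ite_primitiveCharacter {k : ℕ} (χ : DirichletCharacter ℂ k) (n : ℕ) :
    χ n = if n.Coprime k then χ.primitiveCharacter n else 0 := by
  split_ifs with hn
  · have hft := DirichletCharacter.factorsThrough_conductor χ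
    have hdvd : χ.conductor ∣ k := DirichletCharacter.conductor_dvd_level χ
    conv_lhs => rw [hft.eq_changeLevel]
    rw [primitiveCharacter_eq_χ₀]
    have hu := ZMod.coe_unitOfCoprime n hn
    rw [← hu, DirichletCharacter.changeLevel_eq_cast_of_dvd, hu, ZMod.cast_natCast hdvd]
  · exact MulChar.map_nonunit χ (mt (ZMod.isUnit_iff_coprime n k).mp hn)

/-- **Pólya–Vinogradov for a non-principal character.** For `χ ≠ 1` modulo `k` and any interval
`(A, B]`: `|∑_{A < n ≤ B} χ(n)| ≤ τ(k) √k (1 + log k)`. Reduce to the primitive character `χ*`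
inducing `χ`, of conductor `f ∣ k`, `f ≥ 2`: `∑ χ(n) = ∑_{g ∣ k} μ(g) χ*(g) ∑_{A/g < t ≤ B/g} χ*(t)`
(`sum_Ioc_filter_coprime_eq`), and each inner sum is at most `√f (1 + log f)` by the primitive
case `LargeSieve.polyaVinogradov`. [folklore] -/
theorem norm_sum_Ioc_le_of_ne_one {k : ℕ} [NeZero k] {χ : DirichletCharacter ℂ k} (hχ : χ ≠ 1)
    (A B : ℕ) :
    ‖∑ n ∈ Ioc A B, χ n‖ ≤ (σ 0 k : ℝ) * Real.sqrt k * (1 + Real.log k) := by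
  have hk0 : k ≠ 0 := NeZero.ne k
  have hf0 : χ.conductor ≠ 0 := DirichletCharacter.conductor_ne_zero χ
  have hf1 : χ.conductor ≠ 1 := fun h => hχ (DirichletCharacter.eq_one_iff_conductor_eq_one.mpr h)
  have hf2 : 2 ≤ χ.conductor := by omega
  have hfk : χ.conductor ∣ k := DirichletCharacter.conductor_dvd_level χ
  have hfk' : (χ.conductor : ℝ) ≤ k := by
    exact_mod_cast Nat.le_of_dvd (Nat.pos_of_ne_zero hk0) hfk
  have hψp : χ.primitiveCharacter.IsPrimitive := DirichletCharacter.primitiveCharacter_isPrimitive χ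
  haveI : NeZero χ.conductor := ⟨hf0⟩
  have hexp : ∑ n ∈ Ioc A B, χ n =
      ∑ n ∈ (Ioc A B).filter (fun n => n.Coprime k), χ.primitiveCharacter n := by
    rw [sum_filter]
    refine sum_congr rfl fun n _ => ?_
    rw [apply_natCast_eq_ite_primitiveCharacter χ n]
  rw [hexp, mul_assoc]
  have hlogf : 0 ≤ Real.log χ.conductor :=
    Real.log_nonneg (by exact_mod_cast (by omega : 1 ≤ χ.conductor))
  refine norm_sum_Ioc_filter_coprime_le (f := fun n : ℕ => χ.primitiveCharacter n)
    (fun m n => by simp only [Nat.cast_mul, map_mul])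
    (fun n => DirichletCharacter.norm_le_one _ _) (fun A' B' => ?_) hk0 A B
  have hpv : ‖∑ t ∈ Ioc A' B', χ.primitiveCharacter t‖ ≤
      Real.sqrt χ.conductor * (1 + Real.log χ.conductor) := by
    rcases le_or_gt A' B' with hAB | hAB
    · have := LargeSieve.polyaVinogradov hf2 hψp A' (B' - A')
      rwa [Nat.add_sub_cancel' hAB] at this
    · rw [Ioc_eq_empty (by omega), sum_empty, norm_zero]
      positivity
  refine hpv.trans ?_
  have hf0' : (0 : ℝ) < χ.conductor := by exact_mod_cast Nat.pos_of_ne_zero hf0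
  gcongr

/-! ### Lemma 11.2: solutions of `a r ≡ b s (mod d)` in a box -/

/-- Naturals `≤ S` lying in a single residue class modulo `m` number at most `S/m + 1`.
[folklore] -/
theorem card_le_div_add_one_of_dvd_sub {F : Finset ℕ} {S m : ℕ}
    (hF : ∀ s ∈ F, s ≤ S) (hmod : ∀ s ∈ F, ∀ s' ∈ F, (m : ℤ) ∣ (s : ℤ) - s') :
    #F ≤ S / m + 1 := by
  rcases F.eq_empty_or_nonempty with h | hne
  · simp [h]
  have hs₀ : F.min' hne ∈ F := F.min'_mem hne
  have hle : ∀ s ∈ F, F.min' hne ≤ s := fun s hs => F.min'_le s hs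
  have hdvd : ∀ s ∈ F, m ∣ s - F.min' hne := fun s hs => by
    have h := hmod s hs _ hs₀
    rwa [← Nat.cast_sub (hle s hs), Int.natCast_dvd_natCast] at h
  calc #F ≤ #(Icc 0 (S / m)) := by
        refine card_le_card_of_injOn (fun s => (s - F.min' hne) / m) ?_ ?_
        · intro s hs
          rw [mem_coe, mem_Icc]
          exact ⟨Nat.zero_le _, Nat.div_le_div_right ((Nat.sub_le _ _).trans (hF s (mem_coe.mp hs)))⟩
        · intro s hs s' hs' h
          have h1 := Nat.div_mul_cancel (hdvd s (mem_coe.mp hs))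
          have h2 := Nat.div_mul_cancel (hdvd s' (mem_coe.mp hs'))
          have h3 : s - F.min' hne = s' - F.min' hne := by
            rw [← h1, ← h2]
            exact congrArg (· * m) h
          have := hle s (mem_coe.mp hs)
          have := hle s' (mem_coe.mp hs')
          omega
    _ = S / m + 1 := by simp

/-- `#(filter P (A ×ˢ B)) = ∑_{r ∈ A} #{s ∈ B : P (r, s)}`. [folklore] -/
theorem card_filter_product_eq_sum {α β : Type*} (A : Finset α) (B : Finset β)
    (P : α × β → Prop) [DecidablePred P] :
    #((A ×ˢ B).filter P) = ∑ r ∈ A, #(B.filter fun s => P (r, s)) := by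
  rw [card_filter, sum_product]
  refine sum_congr rfl fun r _ => ?_
  rw [card_filter]

/-- The multiples of `β` in `[1, R]` number `R/β`. [folklore] -/
theorem card_Icc_filter_dvd (β R : ℕ) : #((Icc 1 R).filter fun r => β ∣ r) = R / β := by
  rw [show Icc 1 R = Ioc 0 R from val_inj.mp rfl]
  exact Nat.Ioc_filter_dvd_card_eq_div R β

/-- One-sided form of Lemma 11.2: for `(a, b, d) = 1`, `d ≥ 1`, the solutions of
`a r ≡ b s (mod d)` with `1 ≤ r ≤ R`, `1 ≤ s ≤ S` number at most `RS/d + R` ("Dividing the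
congruence by `β = (b, d)` …": `β ∣ r`, and given `r` the class of `s` modulo `d/β` is fixed, so
the count is at most `(R/β)(Sβ/d + 1)`). [cite: FriedlanderIwaniecAnnals1998, Lemma 11.2] -/
theorem card_congrPairs_le_add_left {a b : ℤ} {d : ℕ} (hd : 0 < d)
    (habd : Nat.Coprime (Int.gcd a b) d) (R S : ℕ) :
    (#(((Icc 1 R) ×ˢ (Icc 1 S)).filter fun rs : ℕ × ℕ => (d : ℤ) ∣ a * rs.1 - b * rs.2) : ℝ) ≤
      (R : ℝ) * S / d + R := by
  -- `β = (b, d)`, `d = β d'`, `b = β b'`, `(d', b') = 1`, `(β, a) = 1`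
  set β : ℕ := Int.gcd b d with hβ
  have hdz : (d : ℤ) ≠ 0 := by exact_mod_cast hd.ne'
  have hβ0 : 0 < β := Int.gcd_pos_of_ne_zero_right _ hdz
  have hβz : (β : ℤ) ≠ 0 := by exact_mod_cast hβ0.ne'
  have hβd : β ∣ d := by
    have := Int.gcd_dvd_right b d
    exact Int.natCast_dvd_natCast.mp this
  have hβb : (β : ℤ) ∣ b := Int.gcd_dvd_left b d
  obtain ⟨d', hd'⟩ := hβd
  obtain ⟨b', hb'⟩ := hβb
  have hd'0 : 0 < d' := Nat.pos_of_mul_pos_left (hd' ▸ hd)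
  have hcop : Int.gcd (d' : ℤ) b' = 1 := by
    have h := Int.gcd_div_gcd_div_gcd (i := b) (j := (d : ℤ)) (by rw [← hβ]; exact_mod_cast hβ0)
    rw [← hβ, hb', hd', Nat.cast_mul, Int.mul_ediv_cancel_left _ hβz,
      Int.mul_ediv_cancel_left _ hβz, Int.gcd_comm] at h
    exact h
  have haβ : Int.gcd (β : ℤ) a = 1 := by
    have habd' : Nat.Coprime (Int.gcd a b) β := Nat.Coprime.coprime_dvd_right ⟨d', hd'⟩ habd
    have h1 : ((Int.gcd (β : ℤ) a : ℕ) : ℤ) ∣ a := Int.gcd_dvd_right _ _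
    have h2 : ((Int.gcd (β : ℤ) a : ℕ) : ℤ) ∣ b := (Int.gcd_dvd_left (β : ℤ) a).trans ⟨b', hb'⟩
    have h3 : Int.gcd (β : ℤ) a ∣ Int.gcd a b := Int.dvd_gcd h1 h2
    have h4 : Int.gcd (β : ℤ) a ∣ β := Int.natCast_dvd_natCast.mp (Int.gcd_dvd_left (β : ℤ) a)
    exact (Nat.Coprime.coprime_dvd_left h3 habd').eq_one_of_dvd h4
  -- the fibres
  have hfib : ∀ r ∈ Icc 1 R, #((Icc 1 S).filter fun s : ℕ => (d : ℤ) ∣ a * r - b * s) ≤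
      if β ∣ r then S / d' + 1 else 0 := by
    intro r _
    split_ifs with hβr
    · refine card_le_div_add_one_of_dvd_sub (fun s hs => (mem_Icc.mp (mem_filter.mp hs).1).2) ?_
      intro s hs s' hs'
      have h1 := (mem_filter.mp hs).2
      have h2 := (mem_filter.mp hs').2
      have h3 : (d : ℤ) ∣ b * ((s' : ℤ) - s) := by
        have h := dvd_sub h1 h2
        have he : a * (r : ℤ) - b * s - (a * r - b * s') = b * ((s' : ℤ) - s) := by ring
        rwa [he] at h
      rw [hd', hb', Nat.cast_mul, mul_assoc] at h3
      have h4 : (d' : ℤ) ∣ b' * ((s' : ℤ) - s) := (mul_dvd_mul_iff_left hβz).mp h3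
      have h5 : (d' : ℤ) ∣ (s' : ℤ) - s := Int.dvd_of_dvd_mul_right_of_gcd_one h4 hcop
      have := dvd_neg.mpr h5
      rwa [neg_sub] at this
    · rw [Nat.le_zero, card_eq_zero, filter_eq_empty_iff]
      intro s _ hds
      apply hβr
      have h1 : (β : ℤ) ∣ a * r - b * s := (Dvd.intro _ (by rw [hd', Nat.cast_mul])).trans hds
      have h2 : (β : ℤ) ∣ a * r := by
        have : (β : ℤ) ∣ b * s := (Dvd.intro _ hb'.symm).mul_right _
        simpa using dvd_add h1 this
      exact Int.natCast_dvd_natCast.mp (Int.dvd_of_dvd_mul_right_of_gcd_one h2 haβ)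
  -- count
  have hcount : #(((Icc 1 R) ×ˢ (Icc 1 S)).filter fun rs : ℕ × ℕ => (d : ℤ) ∣ a * rs.1 - b * rs.2) ≤
      R / β * (S / d' + 1) := by
    rw [card_filter_product_eq_sum]
    calc ∑ r ∈ Icc 1 R, #((Icc 1 S).filter fun s : ℕ => (d : ℤ) ∣ a * r - b * s)
        ≤ ∑ r ∈ Icc 1 R, (if β ∣ r then S / d' + 1 else 0) := sum_le_sum hfib
      _ = #((Icc 1 R).filter fun r => β ∣ r) * (S / d' + 1) := by
          rw [← sum_filter, sum_const, smul_eq_mul]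
      _ = R / β * (S / d' + 1) := by rw [card_Icc_filter_dvd]
  -- `(R/β)(S/d' + 1) ≤ (R/β)(Sβ/d + 1) = RS/d + R/β ≤ RS/d + R`
  have hR : ((R / β : ℕ) : ℝ) ≤ (R : ℝ) / β := Nat.cast_div_le
  have hS : ((S / d' : ℕ) : ℝ) ≤ (S : ℝ) / d' := Nat.cast_div_le
  have hβr : (0 : ℝ) < β := by exact_mod_cast hβ0
  have hd'r : (0 : ℝ) < d' := by exact_mod_cast hd'0
  have hdr : (d : ℝ) = β * d' := by rw [hd']; push_cast; ring
  calc (#(((Icc 1 R) ×ˢ (Icc 1 S)).filter fun rs : ℕ × ℕ => (d : ℤ) ∣ a * rs.1 - b * rs.2) : ℝ)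
      ≤ ((R / β * (S / d' + 1) : ℕ) : ℝ) := by exact_mod_cast hcount
    _ = ((R / β : ℕ) : ℝ) * (((S / d' : ℕ) : ℝ) + 1) := by push_cast; ring
    _ ≤ (R : ℝ) / β * ((S : ℝ) / d' + 1) := by gcongr
    _ = (R : ℝ) * S / d + R / β := by rw [hdr]; field_simp
    _ ≤ (R : ℝ) * S / d + R := by
        gcongr
        exact div_le_self (Nat.cast_nonneg R) (by exact_mod_cast hβ0)

/-- **FI Lemma 11.2.** For `(a, b, d) = 1`, `d ≥ 1`, the number `𝒩_d(R, S)` of solutions of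
`a r ≡ b s (mod d)` in integers `1 ≤ r ≤ R`, `1 ≤ s ≤ S` satisfies
`𝒩_d(R, S) ≤ RS/d + min(R, S)` (whence (11.15) `𝒩_d(R, S) ≤ RS/d + √(RS)`,
`card_congrPairs_le_sqrt`), "counting the solutions in two ways".
[cite: FriedlanderIwaniecAnnals1998, Lemma 11.2, (11.15)] -/
theorem card_congrPairs_le {a b : ℤ} {d : ℕ} (hd : 0 < d)
    (habd : Nat.Coprime (Int.gcd a b) d) (R S : ℕ) :
    (#(((Icc 1 R) ×ˢ (Icc 1 S)).filter fun rs : ℕ × ℕ => (d : ℤ) ∣ a * rs.1 - b * rs.2) : ℝ) ≤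
      (R : ℝ) * S / d + min (R : ℝ) S := by
  rcases le_total (R : ℝ) S with hRS | hRS
  · rw [min_eq_left hRS]
    exact card_congrPairs_le_add_left hd habd R S
  · rw [min_eq_right hRS]
    -- swap the roles of `(a, r)` and `(b, s)`
    have hsymm : #(((Icc 1 R) ×ˢ (Icc 1 S)).filter fun rs : ℕ × ℕ => (d : ℤ) ∣ a * rs.1 - b * rs.2) =
        #(((Icc 1 S) ×ˢ (Icc 1 R)).filter fun sr : ℕ × ℕ => (d : ℤ) ∣ b * sr.1 - a * sr.2) := by
      refine card_equiv (Equiv.prodComm ℕ ℕ) fun rs => ?_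
      simp only [mem_filter, mem_product, Equiv.prodComm_apply, Prod.fst_swap, Prod.snd_swap]
      rw [← dvd_neg, neg_sub]
      tauto
    have habd' : Nat.Coprime (Int.gcd b a) d := by rwa [Int.gcd_comm]
    have := card_congrPairs_le_add_left hd habd' S R
    rw [hsymm]
    calc (#(((Icc 1 S) ×ˢ (Icc 1 R)).filter fun sr : ℕ × ℕ => (d : ℤ) ∣ b * sr.1 - a * sr.2) : ℝ)
        ≤ (S : ℝ) * R / d + S := this
      _ = (R : ℝ) * S / d + S := by ring

/-- (11.15) as printed: `𝒩_d(R, S) ≤ RS/d + √(RS)`. [cite: FriedlanderIwaniecAnnals1998, (11.15)] -/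
theorem card_congrPairs_le_sqrt {a b : ℤ} {d : ℕ} (hd : 0 < d)
    (habd : Nat.Coprime (Int.gcd a b) d) (R S : ℕ) :
    (#(((Icc 1 R) ×ˢ (Icc 1 S)).filter fun rs : ℕ × ℕ => (d : ℤ) ∣ a * rs.1 - b * rs.2) : ℝ) ≤
      (R : ℝ) * S / d + Real.sqrt ((R : ℝ) * S) := by
  refine (card_congrPairs_le hd habd R S).trans ?_
  have hR : (0 : ℝ) ≤ R := Nat.cast_nonneg R
  have hS : (0 : ℝ) ≤ S := Nat.cast_nonneg S
  have hmin : min (R : ℝ) S ≤ Real.sqrt ((R : ℝ) * S) := by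
    rw [show min (R : ℝ) S = Real.sqrt (min (R : ℝ) S * min (R : ℝ) S) from
      (Real.sqrt_mul_self (le_min hR hS)).symm]
    refine Real.sqrt_le_sqrt ?_
    rcases le_total (R : ℝ) S with h | h
    · rw [min_eq_left h]; exact mul_le_mul_of_nonneg_left h hR
    · rw [min_eq_right h]; exact mul_le_mul_of_nonneg_right h hS
  linarith

/-! ### Non-squares: a prime to an odd power, and a witness `(a / m) = -1` -/

/-- A positive non-square has a prime factor to an odd power: `a = p^v c`, `v` odd, `p ∤ c`.
[folklore] -/
theorem exists_prime_odd_pow_mul_of_not_isSquare {a : ℕ} (ha : 0 < a) (hsq : ¬IsSquare a) :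
    ∃ p v c : ℕ, p.Prime ∧ Odd v ∧ ¬p ∣ c ∧ 0 < c ∧ a = p ^ v * c := by
  obtain ⟨s, b, hs0, hb0, hbs, hs⟩ := Nat.sq_mul_squarefree_of_pos ha
  have hs1 : s ≠ 1 := by
    rintro rfl
    exact hsq ⟨b, by rw [← hbs]; ring⟩
  set p := s.minFac with hp
  have hpp : p.Prime := Nat.minFac_prime hs1
  have hps : p ∣ s := Nat.minFac_dvd s
  have ha0 : a ≠ 0 := ha.ne'
  refine ⟨p, a.factorization p, a / p ^ a.factorization p, hpp, ?_, Nat.not_dvd_ordCompl hpp ha0,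
    Nat.ordCompl_pos p ha0, (Nat.ordProj_mul_ordCompl_eq_self a p).symm⟩
  -- `v_p(a) = 2 v_p(b) + 1`
  have hb2 : b ^ 2 ≠ 0 := pow_ne_zero _ hb0.ne'
  have hsf : s.factorization p = 1 := by
    have h1 : s.factorization p ≤ 1 := hs.natFactorization_le_one p
    have h2 : 0 < s.factorization p := hpp.factorization_pos_of_dvd hs0.ne' hps
    omega
  rw [← hbs, Nat.factorization_mul hb2 hs0.ne', Finsupp.add_apply, Nat.factorization_pow,
    Finsupp.smul_apply, smul_eq_mul, hsf]
  exact ⟨b.factorization p, rfl⟩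

/-- An odd prime has a quadratic non-residue: some `c` with `(c / p) = -1`. [folklore] -/
theorem exists_jacobiSym_eq_neg_one_of_prime {p : ℕ} (hp : p.Prime) (hp2 : p ≠ 2) :
    ∃ c : ℕ, J((c : ℤ) | p) = -1 := by
  haveI : Fact p.Prime := ⟨hp⟩
  have hchar : ringChar (ZMod p) ≠ 2 := by rwa [ZMod.ringChar_zmod_n]
  obtain ⟨x, hx⟩ := FiniteField.exists_nonsquare hchar
  refine ⟨x.val, ?_⟩
  rw [← jacobiSym.legendreSym.to_jacobiSym, legendreSym.eq_neg_one_iff']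
  rwa [ZMod.natCast_zmod_val]

/-- **A witness of non-principality.** If `a ≥ 1` is not a perfect square there is an odd `m`
with `(a / m) = -1` (Jacobi symbol). Write `a = p^v c` with `v` odd, `p ∤ c`; for `p` odd take
`m ≡ 1 (mod 4c)` and `m` a non-residue mod `p` (so `(c / m) = (c / 1) = 1` by the `4c`-periodicity
of the lower argument and `(p / m) = (m / p) = -1` by reciprocity, `m ≡ 1 (mod 4)`); for `p = 2`
take `m ≡ 5 (mod 8)`, `m ≡ 1 (mod c)` (so `(2 / m) = -1` and `(c / m) = (m / c) = 1`). [folklore] -/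
theorem exists_odd_jacobiSym_eq_neg_one {a : ℕ} (ha : 0 < a) (hsq : ¬IsSquare a) :
    ∃ m : ℕ, Odd m ∧ J((a : ℤ) | m) = -1 := by
  obtain ⟨p, v, c, hp, hv, hpc, hc0, rfl⟩ := exists_prime_odd_pow_mul_of_not_isSquare ha hsq
  rcases eq_or_ne p 2 with rfl | hp2
  · -- `a = 2^v c`, `c` odd
    have hc2 : Nat.Coprime 8 c := by
      have : Nat.Coprime 2 c := (Nat.Prime.coprime_iff_not_dvd Nat.prime_two).mpr hpc
      simpa using this.pow_left 3
    obtain ⟨m, hm8, hmc⟩ := Nat.chineseRemainder hc2 5 1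
    have hm8' : m % 8 = 5 := hm8
    have hmodd : Odd m := Nat.odd_iff.mpr (by omega)
    have hm4 : m % 4 = 1 := by omega
    have hcodd : Odd c := Nat.odd_iff.mpr (by
      rcases Nat.even_or_odd c with h | h
      · exact absurd (even_iff_two_dvd.mp h) hpc
      · exact Nat.odd_iff.mp h)
    refine ⟨m, hmodd, ?_⟩
    have h2 : J((2 : ℕ) | m) = -1 := by
      have hm2 : m % 2 = 1 := by omega
      rw [Nat.cast_ofNat, jacobiSym.at_two hmodd, ZMod.χ₈_nat_eq_if_mod_eight]
      simp [hm8', hm2]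
    have hcm : J((c : ℤ) | m) = 1 := by
      rw [jacobiSym.quadratic_reciprocity_one_mod_four' hcodd hm4]
      rw [jacobiSym.mod_left' (a₂ := 1) ?_, jacobiSym.one_left]
      have : (m : ℤ) ≡ 1 [ZMOD c] := by exact_mod_cast hmc
      exact this
    rw [Nat.cast_mul, Nat.cast_pow, jacobiSym.mul_left, jacobiSym.pow_left, h2, hcm, mul_one,
      hv.neg_one_pow]
  · -- `p` odd
    have hpodd : Odd p := hp.odd_of_ne_two hp2
    have hcop : Nat.Coprime p (4 * c) := by
      refine Nat.Coprime.mul_right ?_ ((Nat.Prime.coprime_iff_not_dvd hp).mpr hpc)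
      have : Nat.Coprime p 2 := (Nat.coprime_primes hp Nat.prime_two).mpr hp2
      simpa using this.pow_right 2
    obtain ⟨r, hr⟩ := exists_jacobiSym_eq_neg_one_of_prime hp hp2
    obtain ⟨m, hmp, hm4c⟩ := Nat.chineseRemainder hcop r 1
    have hm1 : m % (4 * c) = 1 := by
      have : m % (4 * c) = 1 % (4 * c) := hm4c
      rwa [Nat.mod_eq_of_lt (by omega : 1 < 4 * c)] at this
    have hm4 : m % 4 = 1 := by
      have := Nat.mod_mod_of_dvd m (dvd_mul_right 4 c)
      omega
    have hmodd : Odd m := Nat.odd_iff.mpr (by omega)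
    refine ⟨m, hmodd, ?_⟩
    have hpm : J((p : ℤ) | m) = -1 := by
      rw [← jacobiSym.quadratic_reciprocity_one_mod_four hm4 hpodd, jacobiSym.mod_left,
        show (m : ℤ) % p = (r : ℤ) % p by exact_mod_cast hmp, ← jacobiSym.mod_left, hr]
    have hcm : J((c : ℤ) | m) = 1 := by
      rw [jacobiSym.mod_right' c hmodd, hm1, jacobiSym.one_right]
    rw [Nat.cast_mul, Nat.cast_pow, jacobiSym.mul_left, jacobiSym.pow_left, hpm, hcm, mul_one,
      hv.neg_one_pow]

/-- A Dirichlet character (to any modulus) agreeing with `n ↦ (a / n)` at odd `n` is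
non-principal when `a ≥ 1` is not a square. [folklore] -/
theorem ne_one_of_forall_odd_eq_jacobiSym {k : ℕ} {χ : DirichletCharacter ℂ k} {a : ℕ}
    (ha : 0 < a) (hsq : ¬IsSquare a) (hχ : ∀ n : ℕ, Odd n → χ n = (J((a : ℤ) | n) : ℂ)) :
    χ ≠ 1 := by
  obtain ⟨m, hm, hJ⟩ := exists_odd_jacobiSym_eq_neg_one ha hsq
  intro h1
  have h := hχ m hm
  rw [h1, hJ] at h
  by_cases hu : IsUnit (m : ZMod k)
  · rw [MulChar.one_apply hu] at h; norm_num at h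
  · rw [MulChar.map_nonunit _ hu] at h; norm_num at h

/-- **The Jacobi character `(· / q)` is non-principal for `q` odd and not a square.** With
`q = p^v c`, `v` odd, `p ∤ c`: an `r ≡ 1 (mod c)` which is a non-residue mod `p` has
`(r / q) = (r / p)^v (r / c) = -1`. [folklore] -/
theorem jacobiChar_ne_one_of_not_isSquare {q : ℕ} [NeZero q] (hq : Odd q) (hsq : ¬IsSquare q) :
    QuadraticFields.jacobiChar q ≠ 1 := by
  have hq0 : 0 < q := Nat.pos_of_ne_zero (NeZero.ne q)
  obtain ⟨p, v, c, hp, hv, hpc, hc0, hq'⟩ := exists_prime_odd_pow_mul_of_not_isSquare hq0 hsq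
  have hp2 : p ≠ 2 := by
    rintro rfl
    have : 2 ∣ q := hq' ▸ (dvd_pow_self 2 hv.pos.ne').mul_right c
    exact (Nat.not_even_iff_odd.mpr hq) (even_iff_two_dvd.mpr this)
  obtain ⟨r, hr⟩ := exists_jacobiSym_eq_neg_one_of_prime hp hp2
  have hcop : Nat.Coprime p c := (Nat.Prime.coprime_iff_not_dvd hp).mpr hpc
  obtain ⟨m, hmp, hmc⟩ := Nat.chineseRemainder hcop r 1
  have hJ : J((m : ℤ) | q) = -1 := by
    have hpv0 : p ^ v ≠ 0 := pow_ne_zero _ hp.ne_zero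
    rw [hq', jacobiSym.mul_right' _ hpv0 hc0.ne', jacobiSym.pow_right, jacobiSym.mod_left,
      show (m : ℤ) % p = (r : ℤ) % p by exact_mod_cast hmp, ← jacobiSym.mod_left, hr,
      hv.neg_one_pow, jacobiSym.mod_left' (a₂ := 1) (by exact_mod_cast hmc), jacobiSym.one_left]
    norm_num
  intro h1
  have h := QuadraticFields.jacobiChar_natCast (q := q) m
  rw [h1, hJ] at h
  by_cases hu : IsUnit (m : ZMod q)
  · rw [MulChar.one_apply hu] at h; norm_num at h
  · rw [MulChar.map_nonunit _ hu] at h; norm_num at h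


/-! ### Lemma 11.3, first bound: Pólya–Vinogradov in the numerator -/

/-- The character sum of Lemma 11.3 at one modulus: for `n` odd and not a square and `e ≥ 1`,
`|∑_{r ≤ R, (r, e) = 1} (r / n)| ≤ τ(e) τ(n) √n (1 + log n)` ("By the Pólya–Vinogradov bound the
inner sum is `O(τ(e) √q log q)`"; the extra `τ(n)` pays for `(· / n)` being imprimitive when `n`
is not squarefree). [cite: FriedlanderIwaniecAnnals1998, Lemma 11.3, proof] -/
theorem abs_sum_coprime_jacobiSym_le {n : ℕ} (hn : Odd n) (hsq : ¬IsSquare n) {e : ℕ} (he : e ≠ 0)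
    (R : ℕ) :
    |((∑ r ∈ (Icc 1 R).filter (fun r => r.Coprime e), J(r | n) : ℤ) : ℝ)| ≤
      (σ 0 e : ℝ) * ((σ 0 n : ℝ) * Real.sqrt n * (1 + Real.log n)) := by
  haveI : NeZero n := ⟨fun h => by simp [h] at hn⟩
  set χ := QuadraticFields.jacobiChar n with hχ
  have hχ1 : χ ≠ 1 := jacobiChar_ne_one_of_not_isSquare hn hsq
  have hcast : (((∑ r ∈ (Icc 1 R).filter (fun r => r.Coprime e), J(r | n) : ℤ) : ℝ) : ℂ) =
      ∑ r ∈ (Ioc 0 R).filter (fun r => r.Coprime e), χ r := by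
    rw [show Icc 1 R = Ioc 0 R from val_inj.mp rfl]
    push_cast
    refine sum_congr rfl fun r _ => ?_
    rw [hχ, QuadraticFields.jacobiChar_natCast]
  rw [← Real.norm_eq_abs, ← Complex.norm_real, hcast]
  refine norm_sum_Ioc_filter_coprime_le (f := fun r : ℕ => χ r) (fun a b => ?_)
    (fun a => DirichletCharacter.norm_le_one _ _) (fun A B => norm_sum_Ioc_le_of_ne_one hχ1 A B) he 0 R
  simp only [Nat.cast_mul, map_mul]

/-- **FI Lemma 11.3, first bound.** For `e ≥ 1` and `Q, R ≥ 0`: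
`∑_{q ≤ Q, q' ≠ □} |∑_{r ≤ R, (r,e)=1} (r / q')|² ≤ C τ(e)² Q² (1 + log Q)^κ`
(`q'` the odd part of `q`; absolute constants `C, κ`; the printed form is
`≪ τ(e)² Q² (log QR)²`). [cite: FriedlanderIwaniecAnnals1998, Lemma 11.3, (11.16), first bound] -/
theorem sum_sq_coprime_jacobiSym_le_first :
    ∃ C : ℝ, 0 < C ∧ ∃ κ : ℕ, ∀ e Q R : ℕ, 0 < e →
      ∑ q ∈ (Icc 1 Q).filter (fun q => ¬IsSquare (ordCompl[2] q)),
        ((∑ r ∈ (Icc 1 R).filter (fun r => r.Coprime e), J(r | ordCompl[2] q) : ℤ) : ℝ) ^ 2 ≤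
      C * (σ 0 e : ℝ) ^ 2 * (Q : ℝ) ^ 2 * (1 + Real.log Q) ^ κ := by
  obtain ⟨C₂, hC₂, κ₂, h₂⟩ := exists_sum_tau_pow_le_one 2
  refine ⟨C₂, hC₂, κ₂ + 2, fun e Q R he => ?_⟩
  rcases Nat.eq_zero_or_pos Q with rfl | hQ
  · simp
  have hQ1 : (1 : ℝ) ≤ Q := by exact_mod_cast hQ
  have hL : 1 ≤ 1 + Real.log Q := by linarith [Real.log_nonneg hQ1]
  -- termwise bound
  have hterm : ∀ q ∈ (Icc 1 Q).filter (fun q => ¬IsSquare (ordCompl[2] q)),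
      ((∑ r ∈ (Icc 1 R).filter (fun r => r.Coprime e), J(r | ordCompl[2] q) : ℤ) : ℝ) ^ 2 ≤
        (σ 0 e : ℝ) ^ 2 * Q * (1 + Real.log Q) ^ 2 * (σ 0 q : ℝ) ^ 2 := by
    intro q hq
    rw [mem_filter, mem_Icc] at hq
    obtain ⟨⟨hq1, hqQ⟩, hnsq⟩ := hq
    have hq0 : q ≠ 0 := by omega
    set n := ordCompl[2] q with hn
    have hn2 : ¬2 ∣ n := Nat.not_dvd_ordCompl Nat.prime_two hq0
    have hnodd : Odd n := Nat.odd_iff.mpr (Nat.two_dvd_ne_zero.mp hn2)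
    have hndvd : n ∣ q := Nat.ordCompl_dvd q 2
    have hn0 : 0 < n := Nat.ordCompl_pos 2 hq0
    have hnq : n ≤ q := Nat.le_of_dvd (by omega) hndvd
    have hnQ : (n : ℝ) ≤ Q := by exact_mod_cast hnq.trans hqQ
    have hn1 : (1 : ℝ) ≤ n := by exact_mod_cast hn0
    have hσ : (σ 0 n : ℝ) ≤ σ 0 q := by exact_mod_cast sigma_zero_le_of_dvd hq0 hndvd
    have h := abs_sum_coprime_jacobiSym_le hnodd hnsq he.ne' R
    have hb : (σ 0 e : ℝ) * ((σ 0 n : ℝ) * Real.sqrt n * (1 + Real.log n)) ≤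
        (σ 0 e : ℝ) * ((σ 0 q : ℝ) * Real.sqrt Q * (1 + Real.log Q)) := by
      have : 0 ≤ Real.log n := Real.log_nonneg hn1
      gcongr
    have hab := h.trans hb
    have h0 : 0 ≤ (σ 0 e : ℝ) * ((σ 0 q : ℝ) * Real.sqrt Q * (1 + Real.log Q)) := by positivity
    calc ((∑ r ∈ (Icc 1 R).filter (fun r => r.Coprime e), J(r | n) : ℤ) : ℝ) ^ 2
        = |((∑ r ∈ (Icc 1 R).filter (fun r => r.Coprime e), J(r | n) : ℤ) : ℝ)| ^ 2 := (sq_abs _).symm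
      _ ≤ ((σ 0 e : ℝ) * ((σ 0 q : ℝ) * Real.sqrt Q * (1 + Real.log Q))) ^ 2 :=
          pow_le_pow_left₀ (abs_nonneg _) hab 2
      _ = (σ 0 e : ℝ) ^ 2 * Q * (1 + Real.log Q) ^ 2 * (σ 0 q : ℝ) ^ 2 := by
          rw [mul_pow, mul_pow, mul_pow, Real.sq_sqrt (by positivity)]; ring
  calc ∑ q ∈ (Icc 1 Q).filter (fun q => ¬IsSquare (ordCompl[2] q)),
        ((∑ r ∈ (Icc 1 R).filter (fun r => r.Coprime e), J(r | ordCompl[2] q) : ℤ) : ℝ) ^ 2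
      ≤ ∑ q ∈ (Icc 1 Q).filter (fun q => ¬IsSquare (ordCompl[2] q)),
          (σ 0 e : ℝ) ^ 2 * Q * (1 + Real.log Q) ^ 2 * (σ 0 q : ℝ) ^ 2 := sum_le_sum hterm
    _ ≤ ∑ q ∈ Icc 1 Q, (σ 0 e : ℝ) ^ 2 * Q * (1 + Real.log Q) ^ 2 * (σ 0 q : ℝ) ^ 2 :=
        sum_le_sum_of_subset_of_nonneg (filter_subset _ _) fun _ _ _ => by positivity
    _ = (σ 0 e : ℝ) ^ 2 * Q * (1 + Real.log Q) ^ 2 * ∑ q ∈ Icc 1 ⌊(Q : ℝ)⌋₊, (σ 0 q : ℝ) ^ 2 := by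
        rw [← mul_sum, Nat.floor_natCast]
    _ ≤ (σ 0 e : ℝ) ^ 2 * Q * (1 + Real.log Q) ^ 2 * (C₂ * Q * (1 + Real.log Q) ^ κ₂) := by
        gcongr
        exact h₂ Q hQ1
    _ = C₂ * (σ 0 e : ℝ) ^ 2 * (Q : ℝ) ^ 2 * (1 + Real.log Q) ^ (κ₂ + 2) := by ring


/-! ### Lemma 11.3, second bound: Pólya–Vinogradov in the denominator -/

/-- `v₂(2^j m) = j` and the odd part of `2^j m` is `m`, for `m` odd. [folklore] -/
theorem factorization_two_pow_mul_odd {m : ℕ} (hm : Odd m) (j : ℕ) :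
    (2 ^ j * m).factorization 2 = j := by
  have hm0 : m ≠ 0 := fun h => by simp [h] at hm
  rw [Nat.factorization_mul (pow_ne_zero _ two_ne_zero) hm0, Finsupp.add_apply,
    Nat.Prime.factorization_pow Nat.prime_two, Finsupp.single_eq_same,
    Nat.factorization_eq_zero_of_not_dvd (fun h => (Nat.not_even_iff_odd.mpr hm) (even_iff_two_dvd.mpr h)),
    add_zero]

/-- The odd part of `2^j m` is `m`, for `m` odd. [folklore] -/
theorem ordCompl_two_pow_mul_odd {m : ℕ} (hm : Odd m) (j : ℕ) : ordCompl[2] (2 ^ j * m) = m := by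
  rw [factorization_two_pow_mul_odd hm, Nat.mul_div_cancel_left _ (pow_pos two_pos _)]

/-- **Grouping `q ≤ Q` by the power of `2`:** `∑_{q ≤ Q} F(q') = ∑_{j ≤ log₂ Q} ∑_{m ≤ Q/2^j, m odd} F(m)`
(`q = 2^j m`, `q' = m` the odd part). [folklore] -/
theorem sum_Icc_ordCompl_two_eq {M : Type*} [AddCommMonoid M] (F : ℕ → M) (Q : ℕ) :
    ∑ q ∈ Icc 1 Q, F (ordCompl[2] q) =
      ∑ j ∈ range (Nat.log 2 Q + 1), ∑ m ∈ (Icc 1 (Q / 2 ^ j)).filter Odd, F m := by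
  have hσ : ∑ x ∈ (range (Nat.log 2 Q + 1)).sigma (fun j => (Icc 1 (Q / 2 ^ j)).filter Odd), F x.2 =
      ∑ j ∈ range (Nat.log 2 Q + 1), ∑ m ∈ (Icc 1 (Q / 2 ^ j)).filter Odd, F m := sum_sigma _ _ _
  rw [← hσ]
  symm
  refine sum_nbij' (fun x => 2 ^ x.1 * x.2) (fun q => ⟨q.factorization 2, ordCompl[2] q⟩) ?_ ?_ ?_ ?_ ?_
  · rintro ⟨j, m⟩ hx
    rw [mem_sigma, mem_range, mem_filter, mem_Icc] at hx
    obtain ⟨-, ⟨hm1, hmQ⟩, -⟩ := hx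
    rw [mem_Icc]
    refine ⟨Nat.le_mul_of_pos_left m (pow_pos two_pos j) |>.trans' hm1, ?_⟩
    have := (Nat.le_div_iff_mul_le (pow_pos two_pos j)).mp hmQ
    rwa [mul_comm] at this
  · intro q hq
    rw [mem_Icc] at hq
    have hq0 : q ≠ 0 := by omega
    have hdec := Nat.ordProj_mul_ordCompl_eq_self q 2
    rw [mem_sigma, mem_range, mem_filter, mem_Icc]
    refine ⟨?_, ⟨Nat.ordCompl_pos 2 hq0, ?_⟩, ?_⟩
    · refine Nat.lt_succ_of_le (Nat.le_log_of_pow_le one_lt_two ?_)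
      calc 2 ^ q.factorization 2 ≤ 2 ^ q.factorization 2 * ordCompl[2] q :=
            Nat.le_mul_of_pos_right _ (Nat.ordCompl_pos 2 hq0)
        _ = q := hdec
        _ ≤ Q := hq.2
    · rw [Nat.le_div_iff_mul_le (pow_pos two_pos _), mul_comm, hdec]
      exact hq.2
    · exact Nat.odd_iff.mpr (Nat.two_dvd_ne_zero.mp (Nat.not_dvd_ordCompl Nat.prime_two hq0))
  · rintro ⟨j, m⟩ hx
    rw [mem_sigma, mem_range, mem_filter] at hx
    have hm : Odd m := hx.2.2
    show (⟨(2 ^ j * m).factorization 2, ordCompl[2] (2 ^ j * m)⟩ : Σ _ : ℕ, ℕ) = ⟨j, m⟩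
    rw [ordCompl_two_pow_mul_odd hm, factorization_two_pow_mul_odd hm]
  · intro q _
    exact Nat.ordProj_mul_ordCompl_eq_self q 2
  · rintro ⟨j, m⟩ hx
    rw [mem_sigma, mem_range, mem_filter] at hx
    simp only [ordCompl_two_pow_mul_odd hx.2.2]

/-- `log₂ Q + 1 ≤ 2 (1 + log Q)` for `Q ≥ 1` (the number of powers of `2` below `Q`). [folklore] -/
theorem natLog_two_add_one_le {Q : ℕ} (hQ : 0 < Q) :
    (Nat.log 2 Q : ℝ) + 1 ≤ 2 * (1 + Real.log Q) := by
  have h1 : (2 : ℝ) ^ Nat.log 2 Q ≤ Q := by exact_mod_cast Nat.pow_log_le_self 2 hQ.ne'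
  have h2 : (Nat.log 2 Q : ℝ) * Real.log 2 ≤ Real.log Q := by
    rw [← Real.log_pow]
    exact Real.log_le_log (by positivity) h1
  have h3 := Real.log_two_gt_d9
  have h4 : (Nat.log 2 Q : ℝ) ≤ 2 * Real.log Q := by nlinarith
  linarith

/-- A Dirichlet character to an even modulus vanishes at even arguments. [folklore] -/
theorem apply_eq_zero_of_even_of_even {k : ℕ} [NeZero k] (hk : Even k) (χ : DirichletCharacter ℂ k)
    {n : ℕ} (hn : Even n) : χ n = 0 := by
  refine MulChar.map_nonunit χ fun hu => ?_
  have hcop : n.Coprime k := (ZMod.isUnit_iff_coprime n k).mp hu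
  have h2 : 2 ∣ Nat.gcd n k := Nat.dvd_gcd (even_iff_two_dvd.mp hn) (even_iff_two_dvd.mp hk)
  rw [hcop] at h2
  omega

/-- **The Kronecker symbol over odd parts, summed over the modulus.** For `a ≥ 1` not a square
and `Q ≥ 1`: `|∑_{q ≤ Q} (a / q')| ≤ (log₂ Q + 1) · τ(4a) √(4a) (1 + log 4a)` — group `q = 2^j m`
(`sum_Icc_ordCompl_two_eq`); for each `j` the sum over odd `m ≤ Q/2^j` of `(a / m)` is an
interval sum of the Kronecker character modulo `4a` (`exists_dirichletCharacter_four_mul`), which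
is non-principal (`ne_one_of_forall_odd_eq_jacobiSym`), so Pólya–Vinogradov applies ("The
remaining terms contribute `O(R³ (log Q)(log R))` by the Pólya–Vinogradov estimate").
[cite: FriedlanderIwaniecAnnals1998, Lemma 11.3, proof] -/
theorem abs_sum_jacobiSym_ordCompl_le {a : ℕ} (ha : 0 < a) (hsq : ¬IsSquare a) (Q : ℕ) :
    |((∑ q ∈ Icc 1 Q, J((a : ℤ) | ordCompl[2] q) : ℤ) : ℝ)| ≤
      ((Nat.log 2 Q : ℝ) + 1) * ((σ 0 (4 * a) : ℝ) * Real.sqrt (4 * a) * (1 + Real.log (4 * a))) := by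
  -- the Kronecker character mod `4a`
  have hex := QuadraticFields.exists_dirichletCharacter_four_mul (m := (a : ℤ)) (by exact_mod_cast ha.ne')
  simp only [Int.natAbs_natCast] at hex
  obtain ⟨ψ, hψ⟩ := hex
  haveI : NeZero (4 * a) := ⟨by omega⟩
  have hψ1 : ψ ≠ 1 := ne_one_of_forall_odd_eq_jacobiSym ha hsq hψ
  have h4 : Even (4 * a) := ⟨2 * a, by ring⟩
  -- the inner sums are interval sums of `ψ`
  have hinner : ∀ y : ℕ, (((∑ m ∈ (Icc 1 y).filter Odd, J((a : ℤ) | m) : ℤ) : ℝ) : ℂ) =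
      ∑ m ∈ Ioc 0 y, ψ m := by
    intro y
    rw [show Icc 1 y = Ioc 0 y from val_inj.mp rfl]
    push_cast
    rw [← sum_filter_of_ne (s := Ioc 0 y) (f := fun m : ℕ => ψ (m : ZMod (4 * a))) (p := Odd)
      (fun m _ hm => ?_)]
    · exact sum_congr rfl fun m hm => (hψ m (mem_filter.mp hm).2).symm
    · by_contra hodd
      exact hm (apply_eq_zero_of_even_of_even h4 ψ (Nat.not_odd_iff_even.mp hodd))
  have hB : ∀ y : ℕ, |((∑ m ∈ (Icc 1 y).filter Odd, J((a : ℤ) | m) : ℤ) : ℝ)| ≤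
      (σ 0 (4 * a) : ℝ) * Real.sqrt (4 * a) * (1 + Real.log (4 * a)) := by
    intro y
    rw [← Real.norm_eq_abs, ← Complex.norm_real, hinner]
    have := norm_sum_Ioc_le_of_ne_one hψ1 0 y
    push_cast at this
    exact this
  rw [sum_Icc_ordCompl_two_eq (fun n => J((a : ℤ) | n)) Q]
  push_cast
  refine (abs_sum_le_sum_abs _ _).trans ?_
  calc ∑ j ∈ range (Nat.log 2 Q + 1), |∑ m ∈ (Icc 1 (Q / 2 ^ j)).filter Odd, (J((a : ℤ) | m) : ℝ)|
      ≤ ∑ j ∈ range (Nat.log 2 Q + 1),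
          (σ 0 (4 * a) : ℝ) * Real.sqrt (4 * a) * (1 + Real.log (4 * a)) := by
        refine sum_le_sum fun j _ => ?_
        have := hB (Q / 2 ^ j)
        push_cast at this
        exact this
    _ = ((Nat.log 2 Q : ℝ) + 1) * ((σ 0 (4 * a) : ℝ) * Real.sqrt (4 * a) * (1 + Real.log (4 * a))) := by
        rw [sum_const, card_range, nsmul_eq_mul]; push_cast; ring

/-- **Pairs with a square product.** `#{(r₁, r₂) ∈ [1, R]² : r₁ r₂ = □} ≤ ∑_{t ≤ R} τ(t)²`:
such a pair is `(r₁, t²/r₁)` with `t = √(r₁ r₂) ≤ R` and `r₁ ∣ t²`, and `τ(t²) ≤ τ(t)²`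
("The terms with `r₁ r₂ = □` contribute `O(QR log R)` by trivial estimation").
[cite: FriedlanderIwaniecAnnals1998, Lemma 11.3, proof] -/
theorem card_filter_isSquare_mul_le (R : ℕ) :
    (#(((Icc 1 R) ×ˢ (Icc 1 R)).filter fun p : ℕ × ℕ => IsSquare (p.1 * p.2)) : ℝ) ≤
      ∑ t ∈ Icc 1 R, (σ 0 t : ℝ) ^ 2 := by
  have h1 : #(((Icc 1 R) ×ˢ (Icc 1 R)).filter fun p : ℕ × ℕ => IsSquare (p.1 * p.2)) ≤
      #((Icc 1 R).sigma fun t => (t * t).divisors) := by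
    refine card_le_card_of_injOn (fun p => (⟨Nat.sqrt (p.1 * p.2), p.1⟩ : Σ _ : ℕ, ℕ)) ?_ ?_
    · intro p hp
      rw [mem_coe, mem_filter, mem_product, mem_Icc, mem_Icc] at hp
      obtain ⟨⟨⟨h1, h2⟩, h3, h4⟩, ⟨c, hc⟩⟩ := hp
      have hs : Nat.sqrt (p.1 * p.2) = c := by rw [hc, Nat.sqrt_eq]
      have hc0 : 0 < c := by
        rcases Nat.eq_zero_or_pos c with rfl | h
        · rw [mul_zero] at hc
          exact absurd hc (Nat.mul_ne_zero (by omega) (by omega))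
        · exact h
      have hcR : c ≤ R := by
        by_contra h
        push Not at h
        have : R * R < c * c := Nat.mul_self_lt_mul_self h
        nlinarith
      simp only [mem_coe, mem_sigma, mem_Icc, Nat.mem_divisors, hs]
      exact ⟨⟨hc0, hcR⟩, ⟨p.2, hc.symm⟩, (Nat.mul_pos hc0 hc0).ne'⟩
    · intro p hp p' hp' h
      simp only [Sigma.mk.inj_iff, heq_eq_eq] at h
      obtain ⟨hs, h1⟩ := h
      rw [mem_coe, mem_filter, mem_product, mem_Icc] at hp hp'
      obtain ⟨c, hc⟩ := hp.2
      obtain ⟨c', hc'⟩ := hp'.2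
      rw [hc, hc', Nat.sqrt_eq, Nat.sqrt_eq] at hs
      subst hs
      have hprod : p.1 * p.2 = p'.1 * p'.2 := by rw [hc, hc']
      rw [h1] at hprod
      have hp1 : 0 < p'.1 := hp'.1.1.1
      exact Prod.ext h1 (Nat.eq_of_mul_eq_mul_left hp1 hprod)
  calc (#(((Icc 1 R) ×ˢ (Icc 1 R)).filter fun p : ℕ × ℕ => IsSquare (p.1 * p.2)) : ℝ)
      ≤ #((Icc 1 R).sigma fun t => (t * t).divisors) := by exact_mod_cast h1
    _ = ∑ t ∈ Icc 1 R, (σ 0 (t * t) : ℝ) := by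
        rw [card_sigma]; push_cast
        exact sum_congr rfl fun t _ => by rw [ArithmeticFunction.sigma_zero_apply]
    _ ≤ ∑ t ∈ Icc 1 R, (σ 0 t : ℝ) ^ 2 := by
        refine sum_le_sum fun t _ => ?_
        rw [sq]; exact_mod_cast sigma_zero_mul_le t t



/-- Squaring out: `∑_q (∑_{r ∈ F} (r / g(q)))² = ∑_{(r₁, r₂) ∈ F²} ∑_q (r₁ r₂ / g(q))`. [folklore] -/
theorem sum_sq_sum_jacobiSym_eq (F : Finset ℕ) (S : Finset ℕ) (g : ℕ → ℕ) :
    ∑ q ∈ S, (∑ r ∈ F, J((r : ℤ) | g q)) ^ 2 =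
      ∑ p ∈ F ×ˢ F, ∑ q ∈ S, J(((p.1 * p.2 : ℕ) : ℤ) | g q) := by
  rw [sum_comm]
  refine sum_congr rfl fun q _ => ?_
  rw [sq, sum_mul_sum, ← sum_product']
  refine sum_congr rfl fun p _ => ?_
  rw [Nat.cast_mul, jacobiSym.mul_left]

/-- `|(a / n)| ≤ 1`. [folklore] -/
theorem abs_jacobiSym_le_one (a : ℤ) (n : ℕ) : |(J(a | n) : ℝ)| ≤ 1 := by
  rcases jacobiSym.trichotomy a n with h | h | h <;> simp [h]

/-- `τ(4) = 3`. [folklore] -/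
theorem sigma_zero_four : σ 0 4 = 3 := by
  rw [ArithmeticFunction.sigma_zero_apply]; decide

/-- **FI Lemma 11.3, second bound.** For all `e, Q, R`:
`∑_{q ≤ Q} |∑_{r ≤ R, (r,e)=1} (r / q')|² ≤ C (QR + R³) ((1 + log Q)(1 + log R))^κ`
(`q'` the odd part of `q`; absolute `C, κ`; printed: `≪ (QR + R³)(log QR)²`). Squaring out, the
pairs `r₁ r₂ = □` contribute at most `Q ∑_{t ≤ R} τ(t)²` (`card_filter_isSquare_mul_le`) and each
other pair at most `(log₂ Q + 1) τ(4r₁r₂) √(4 r₁ r₂)(1 + log 4r₁r₂)` (`abs_sum_jacobiSym_ordCompl_le`).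
[cite: FriedlanderIwaniecAnnals1998, Lemma 11.3, (11.16), second bound] -/
theorem sum_sq_coprime_jacobiSym_le_second :
    ∃ C : ℝ, 0 < C ∧ ∃ κ : ℕ, ∀ e Q R : ℕ,
      ∑ q ∈ Icc 1 Q, ((∑ r ∈ (Icc 1 R).filter (fun r => r.Coprime e), J(r | ordCompl[2] q) : ℤ) : ℝ) ^ 2 ≤
      C * ((Q : ℝ) * R + (R : ℝ) ^ 3) * ((1 + Real.log Q) * (1 + Real.log R)) ^ κ := by
  obtain ⟨C₁, hC₁, κ₁, h₁⟩ := exists_sum_tau_pow_le_one 1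
  obtain ⟨C₂, hC₂, κ₂, h₂⟩ := exists_sum_tau_pow_le_one 2
  refine ⟨C₂ + 36 * C₁ ^ 2, by positivity, κ₂ + 2 * κ₁ + 1, fun e Q R => ?_⟩
  rcases Nat.eq_zero_or_pos Q with rfl | hQ
  · simp only [zero_lt_one, Icc_eq_empty_of_lt, sum_empty, CharP.cast_eq_zero, zero_mul, zero_add,
      Real.log_zero, add_zero, one_mul]
    positivity
  rcases Nat.eq_zero_or_pos R with rfl | hR
  · simp only [zero_lt_one, Icc_eq_empty_of_lt, filter_empty, sum_empty, Int.cast_zero, ne_eq,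
      OfNat.ofNat_ne_zero, not_false_eq_true, zero_pow, sum_const_zero, CharP.cast_eq_zero, mul_zero,
      Real.log_zero, add_zero, mul_one]
    positivity
  have hQ1 : (1 : ℝ) ≤ Q := by exact_mod_cast hQ
  have hR1 : (1 : ℝ) ≤ R := by exact_mod_cast hR
  have hLQ : 1 ≤ 1 + Real.log Q := by linarith [Real.log_nonneg hQ1]
  have hLR : 1 ≤ 1 + Real.log R := by linarith [Real.log_nonneg hR1]
  set F := (Icc 1 R).filter (fun r => r.Coprime e) with hF
  have hFsub : F ⊆ Icc 1 R := filter_subset _ _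
  set U : ℕ → ℤ := fun a => ∑ q ∈ Icc 1 Q, J((a : ℤ) | ordCompl[2] q) with hU
  -- squaring out and exchanging the order of summation
  have hexp : ∑ q ∈ Icc 1 Q, ((∑ r ∈ F, J((r : ℤ) | ordCompl[2] q) : ℤ) : ℝ) ^ 2 =
      ∑ p ∈ F ×ˢ F, (U (p.1 * p.2) : ℝ) := by
    simp only [hU]
    have h := congrArg (fun z : ℤ => (z : ℝ)) (sum_sq_sum_jacobiSym_eq F (Icc 1 Q) (fun q => ordCompl[2] q))
    push_cast at h ⊢
    exact h
  rw [hexp, ← sum_filter_add_sum_filter_not (F ×ˢ F) (fun p : ℕ × ℕ => IsSquare (p.1 * p.2))]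
  -- the square pairs
  have hUQ : ∀ a : ℕ, |(U a : ℝ)| ≤ Q := by
    intro a
    simp only [hU, Int.cast_sum]
    refine (abs_sum_le_sum_abs _ _).trans ?_
    calc ∑ q ∈ Icc 1 Q, |(J((a : ℤ) | ordCompl[2] q) : ℝ)| ≤ ∑ q ∈ Icc 1 Q, (1 : ℝ) :=
          sum_le_sum fun q _ => abs_jacobiSym_le_one _ _
      _ = Q := by simp
  have hsq : ∑ p ∈ (F ×ˢ F).filter (fun p : ℕ × ℕ => IsSquare (p.1 * p.2)), (U (p.1 * p.2) : ℝ) ≤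
      C₂ * ((Q : ℝ) * R) * (1 + Real.log R) ^ κ₂ := by
    have hcard : (#((F ×ˢ F).filter (fun p : ℕ × ℕ => IsSquare (p.1 * p.2))) : ℝ) ≤
        C₂ * R * (1 + Real.log R) ^ κ₂ := by
      calc (#((F ×ˢ F).filter (fun p : ℕ × ℕ => IsSquare (p.1 * p.2))) : ℝ)
          ≤ #(((Icc 1 R) ×ˢ (Icc 1 R)).filter fun p : ℕ × ℕ => IsSquare (p.1 * p.2)) := by
            exact_mod_cast card_le_card (filter_subset_filter _ (product_subset_product hFsub hFsub))
        _ ≤ ∑ t ∈ Icc 1 R, (σ 0 t : ℝ) ^ 2 := card_filter_isSquare_mul_le R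
        _ = ∑ t ∈ Icc 1 ⌊(R : ℝ)⌋₊, (σ 0 t : ℝ) ^ 2 := by rw [Nat.floor_natCast]
        _ ≤ C₂ * R * (1 + Real.log R) ^ κ₂ := h₂ R hR1
    calc ∑ p ∈ (F ×ˢ F).filter (fun p : ℕ × ℕ => IsSquare (p.1 * p.2)), (U (p.1 * p.2) : ℝ)
        ≤ ∑ p ∈ (F ×ˢ F).filter (fun p : ℕ × ℕ => IsSquare (p.1 * p.2)), (Q : ℝ) :=
          sum_le_sum fun p _ => (le_abs_self _).trans (hUQ _)
      _ = #((F ×ˢ F).filter (fun p : ℕ × ℕ => IsSquare (p.1 * p.2))) * (Q : ℝ) := by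
          rw [sum_const, nsmul_eq_mul]
      _ ≤ C₂ * R * (1 + Real.log R) ^ κ₂ * Q := by gcongr
      _ = C₂ * ((Q : ℝ) * R) * (1 + Real.log R) ^ κ₂ := by ring
  -- the non-square pairs
  have hlog4 : Real.log 4 ≤ 2 := by
    have := Real.log_two_lt_d9
    rw [show (4 : ℝ) = 2 ^ 2 by norm_num, Real.log_pow]
    push_cast
    linarith
  have hterm : ∀ p ∈ (F ×ˢ F).filter (fun p : ℕ × ℕ => ¬IsSquare (p.1 * p.2)),
      (U (p.1 * p.2) : ℝ) ≤
        36 * R * (1 + Real.log Q) * (1 + Real.log R) * ((σ 0 p.1 : ℝ) * (σ 0 p.2 : ℝ)) := by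
    intro p hp
    rw [mem_filter, mem_product] at hp
    obtain ⟨⟨hp1, hp2⟩, hnsq⟩ := hp
    have hr1 := mem_Icc.mp (hFsub hp1)
    have hr2 := mem_Icc.mp (hFsub hp2)
    have ha : 0 < p.1 * p.2 := Nat.mul_pos hr1.1 hr2.1
    have haR : ((p.1 * p.2 : ℕ) : ℝ) ≤ (R : ℝ) ^ 2 := by
      rw [sq]; exact_mod_cast Nat.mul_le_mul hr1.2 hr2.2
    have h := (le_abs_self _).trans (abs_sum_jacobiSym_ordCompl_le ha hnsq Q)
    refine h.trans ?_
    -- the four factors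
    have f1 : (Nat.log 2 Q : ℝ) + 1 ≤ 2 * (1 + Real.log Q) := natLog_two_add_one_le hQ
    have f2 : (σ 0 (4 * (p.1 * p.2)) : ℝ) ≤ 3 * ((σ 0 p.1 : ℝ) * (σ 0 p.2 : ℝ)) := by
      have h1 := sigma_zero_mul_le 4 (p.1 * p.2)
      have h2 := sigma_zero_mul_le p.1 p.2
      rw [sigma_zero_four] at h1
      calc (σ 0 (4 * (p.1 * p.2)) : ℝ) ≤ ((3 * σ 0 (p.1 * p.2) : ℕ) : ℝ) := by exact_mod_cast h1
        _ ≤ ((3 * (σ 0 p.1 * σ 0 p.2) : ℕ) : ℝ) := by exact_mod_cast Nat.mul_le_mul_left 3 h2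
        _ = 3 * ((σ 0 p.1 : ℝ) * (σ 0 p.2 : ℝ)) := by push_cast; ring
    have f3 : Real.sqrt (4 * ((p.1 * p.2 : ℕ) : ℝ)) ≤ 2 * R := by
      rw [show (2 : ℝ) * R = Real.sqrt ((2 * R) ^ 2) from (Real.sqrt_sq (by positivity)).symm]
      exact Real.sqrt_le_sqrt (by nlinarith)
    have f4 : 1 + Real.log (4 * ((p.1 * p.2 : ℕ) : ℝ)) ≤ 3 * (1 + Real.log R) := by
      have ha' : (0 : ℝ) < ((p.1 * p.2 : ℕ) : ℝ) := by exact_mod_cast ha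
      rw [Real.log_mul (by norm_num) ha'.ne']
      have : Real.log ((p.1 * p.2 : ℕ) : ℝ) ≤ 2 * Real.log R := by
        have h' := Real.log_le_log ha' haR
        rw [Real.log_pow] at h'
        push_cast at h' ⊢
        linarith
      linarith [Real.log_nonneg hR1]
    have hpos4 : 0 ≤ 1 + Real.log (4 * ((p.1 * p.2 : ℕ) : ℝ)) := by
      have : (1 : ℝ) ≤ 4 * ((p.1 * p.2 : ℕ) : ℝ) := by
        have : (1 : ℝ) ≤ ((p.1 * p.2 : ℕ) : ℝ) := by exact_mod_cast ha
        linarith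
      linarith [Real.log_nonneg this]
    have g0 : 0 ≤ (σ 0 (4 * (p.1 * p.2)) : ℝ) * Real.sqrt (4 * ((p.1 * p.2 : ℕ) : ℝ)) *
        (1 + Real.log (4 * ((p.1 * p.2 : ℕ) : ℝ))) := by
      positivity
    push_cast at f2 f3 f4 g0 hpos4 ⊢
    calc ((Nat.log 2 Q : ℝ) + 1) * ((σ 0 (4 * (p.1 * p.2)) : ℝ) * Real.sqrt (4 * ((p.1 : ℝ) * p.2)) *
          (1 + Real.log (4 * ((p.1 : ℝ) * p.2))))
        ≤ (2 * (1 + Real.log Q)) * (3 * ((σ 0 p.1 : ℝ) * (σ 0 p.2 : ℝ)) * (2 * R) * (3 * (1 + Real.log R))) := by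
          refine mul_le_mul f1 ?_ g0 (by positivity)
          exact mul_le_mul (mul_le_mul f2 f3 (Real.sqrt_nonneg _) (by positivity)) f4 hpos4 (by positivity)
      _ = 36 * R * (1 + Real.log Q) * (1 + Real.log R) * ((σ 0 p.1 : ℝ) * (σ 0 p.2 : ℝ)) := by ring
  have hnsq : ∑ p ∈ (F ×ˢ F).filter (fun p : ℕ × ℕ => ¬IsSquare (p.1 * p.2)), (U (p.1 * p.2) : ℝ) ≤
      36 * C₁ ^ 2 * (R : ℝ) ^ 3 * (1 + Real.log Q) * (1 + Real.log R) ^ (2 * κ₁ + 1) := by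
    have hS1 : ∑ r ∈ F, (σ 0 r : ℝ) ≤ C₁ * R * (1 + Real.log R) ^ κ₁ := by
      calc ∑ r ∈ F, (σ 0 r : ℝ) ≤ ∑ r ∈ Icc 1 R, (σ 0 r : ℝ) :=
            sum_le_sum_of_subset_of_nonneg hFsub fun _ _ _ => by positivity
        _ = ∑ r ∈ Icc 1 ⌊(R : ℝ)⌋₊, (σ 0 r : ℝ) ^ 1 := by
            rw [Nat.floor_natCast]; simp
        _ ≤ C₁ * R * (1 + Real.log R) ^ κ₁ := h₁ R hR1
    have hS0 : 0 ≤ ∑ r ∈ F, (σ 0 r : ℝ) := sum_nonneg fun _ _ => by positivity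
    calc ∑ p ∈ (F ×ˢ F).filter (fun p : ℕ × ℕ => ¬IsSquare (p.1 * p.2)), (U (p.1 * p.2) : ℝ)
        ≤ ∑ p ∈ (F ×ˢ F).filter (fun p : ℕ × ℕ => ¬IsSquare (p.1 * p.2)),
            36 * R * (1 + Real.log Q) * (1 + Real.log R) * ((σ 0 p.1 : ℝ) * (σ 0 p.2 : ℝ)) :=
          sum_le_sum hterm
      _ ≤ ∑ p ∈ F ×ˢ F, 36 * R * (1 + Real.log Q) * (1 + Real.log R) * ((σ 0 p.1 : ℝ) * (σ 0 p.2 : ℝ)) :=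
          sum_le_sum_of_subset_of_nonneg (filter_subset _ _) fun _ _ _ => by positivity
      _ = 36 * R * (1 + Real.log Q) * (1 + Real.log R) * (∑ r ∈ F, (σ 0 r : ℝ)) ^ 2 := by
          rw [← mul_sum, sq, sum_mul_sum, ← sum_product']
      _ ≤ 36 * R * (1 + Real.log Q) * (1 + Real.log R) * (C₁ * R * (1 + Real.log R) ^ κ₁) ^ 2 := by
          gcongr
      _ = 36 * C₁ ^ 2 * (R : ℝ) ^ 3 * (1 + Real.log Q) * (1 + Real.log R) ^ (2 * κ₁ + 1) := by ring
  -- combine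
  set Λ := (1 + Real.log Q) * (1 + Real.log R) with hΛ
  have hΛ1 : 1 ≤ Λ := by rw [hΛ]; nlinarith
  have e1 : (1 + Real.log R) ^ κ₂ ≤ Λ ^ (κ₂ + 2 * κ₁ + 1) := by
    calc (1 + Real.log R) ^ κ₂ ≤ Λ ^ κ₂ := by
          refine pow_le_pow_left₀ (by linarith) ?_ _
          rw [hΛ]; nlinarith
      _ ≤ Λ ^ (κ₂ + 2 * κ₁ + 1) := pow_le_pow_right₀ hΛ1 (by omega)
  have e2 : (1 + Real.log Q) * (1 + Real.log R) ^ (2 * κ₁ + 1) ≤ Λ ^ (κ₂ + 2 * κ₁ + 1) := by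
    calc (1 + Real.log Q) * (1 + Real.log R) ^ (2 * κ₁ + 1)
        ≤ (1 + Real.log Q) ^ (2 * κ₁ + 1) * (1 + Real.log R) ^ (2 * κ₁ + 1) := by
          refine mul_le_mul_of_nonneg_right ?_ (by positivity)
          exact le_self_pow₀ hLQ (by omega)
      _ = Λ ^ (2 * κ₁ + 1) := by rw [hΛ, mul_pow]
      _ ≤ Λ ^ (κ₂ + 2 * κ₁ + 1) := pow_le_pow_right₀ hΛ1 (by omega)
  calc ∑ p ∈ (F ×ˢ F).filter (fun p : ℕ × ℕ => IsSquare (p.1 * p.2)), (U (p.1 * p.2) : ℝ) +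
        ∑ p ∈ (F ×ˢ F).filter (fun p : ℕ × ℕ => ¬IsSquare (p.1 * p.2)), (U (p.1 * p.2) : ℝ)
      ≤ C₂ * ((Q : ℝ) * R) * (1 + Real.log R) ^ κ₂ +
          36 * C₁ ^ 2 * (R : ℝ) ^ 3 * (1 + Real.log Q) * (1 + Real.log R) ^ (2 * κ₁ + 1) :=
        add_le_add hsq hnsq
    _ ≤ C₂ * ((Q : ℝ) * R) * Λ ^ (κ₂ + 2 * κ₁ + 1) +
          36 * C₁ ^ 2 * (R : ℝ) ^ 3 * Λ ^ (κ₂ + 2 * κ₁ + 1) := by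
        have : 36 * C₁ ^ 2 * (R : ℝ) ^ 3 * (1 + Real.log Q) * (1 + Real.log R) ^ (2 * κ₁ + 1) =
            36 * C₁ ^ 2 * (R : ℝ) ^ 3 * ((1 + Real.log Q) * (1 + Real.log R) ^ (2 * κ₁ + 1)) := by ring
        rw [this]
        gcongr
    _ ≤ (C₂ + 36 * C₁ ^ 2) * ((Q : ℝ) * R + (R : ℝ) ^ 3) * Λ ^ (κ₂ + 2 * κ₁ + 1) := by
        have hΛp : 0 ≤ Λ ^ (κ₂ + 2 * κ₁ + 1) := by positivity
        have hQR : 0 ≤ (Q : ℝ) * R := by positivity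
        have hR3 : 0 ≤ (R : ℝ) ^ 3 := by positivity
        nlinarith [mul_nonneg (mul_nonneg hC₂.le hR3) hΛp, mul_nonneg (mul_nonneg (by positivity : (0:ℝ) ≤ 36 * C₁ ^ 2) hQR) hΛp]


/-- **FI Lemma 11.3** ((11.16), both bounds at once): for `e ≥ 1` and all `Q, R`,
`∑_{q ≤ Q, q' ≠ □} |∑_{r ≤ R, (r,e)=1} (r / q')|² ≤ C min{τ(e)² Q², QR + R³} ((1 + log Q)(1 + log R))^κ`
with absolute `C, κ` (printed with `(log QR)²`; only the shape `min{…} (QR)^ε` is used, in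
Lemma 11.4). [cite: FriedlanderIwaniecAnnals1998, Lemma 11.3, (11.16)] -/
theorem sum_sq_coprime_jacobiSym_le_min :
    ∃ C : ℝ, 0 < C ∧ ∃ κ : ℕ, ∀ e Q R : ℕ, 0 < e →
      ∑ q ∈ (Icc 1 Q).filter (fun q => ¬IsSquare (ordCompl[2] q)),
        ((∑ r ∈ (Icc 1 R).filter (fun r => r.Coprime e), J(r | ordCompl[2] q) : ℤ) : ℝ) ^ 2 ≤
      C * min ((σ 0 e : ℝ) ^ 2 * (Q : ℝ) ^ 2) ((Q : ℝ) * R + (R : ℝ) ^ 3) *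
        ((1 + Real.log Q) * (1 + Real.log R)) ^ κ := by
  obtain ⟨C₁, hC₁, κ₁, h₁⟩ := sum_sq_coprime_jacobiSym_le_first
  obtain ⟨C₂, hC₂, κ₂, h₂⟩ := sum_sq_coprime_jacobiSym_le_second
  refine ⟨max C₁ C₂, lt_max_of_lt_left hC₁, max κ₁ κ₂, fun e Q R he => ?_⟩
  rcases Nat.eq_zero_or_pos Q with rfl | hQ
  · simp only [zero_lt_one, Icc_eq_empty_of_lt, filter_empty, sum_empty]
    positivity
  rcases Nat.eq_zero_or_pos R with rfl | hR
  · simp only [zero_lt_one, Icc_eq_empty_of_lt, filter_empty, sum_empty, Int.cast_zero, ne_eq,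
      OfNat.ofNat_ne_zero, not_false_eq_true, zero_pow, sum_const_zero]
    positivity
  have hQ1 : (1 : ℝ) ≤ Q := by exact_mod_cast hQ
  have hR1 : (1 : ℝ) ≤ R := by exact_mod_cast hR
  have hLQ : 1 ≤ 1 + Real.log Q := by linarith [Real.log_nonneg hQ1]
  have hLR : 1 ≤ 1 + Real.log R := by linarith [Real.log_nonneg hR1]
  have hΛ1 : 1 ≤ (1 + Real.log Q) * (1 + Real.log R) := by nlinarith
  set LHS := ∑ q ∈ (Icc 1 Q).filter (fun q => ¬IsSquare (ordCompl[2] q)),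
        ((∑ r ∈ (Icc 1 R).filter (fun r => r.Coprime e), J(r | ordCompl[2] q) : ℤ) : ℝ) ^ 2
  have hA : LHS ≤ max C₁ C₂ * ((σ 0 e : ℝ) ^ 2 * (Q : ℝ) ^ 2) *
      ((1 + Real.log Q) * (1 + Real.log R)) ^ max κ₁ κ₂ := by
    refine (h₁ e Q R he).trans ?_
    have e1 : (1 + Real.log Q) ^ κ₁ ≤ ((1 + Real.log Q) * (1 + Real.log R)) ^ max κ₁ κ₂ :=
      calc (1 + Real.log Q) ^ κ₁ ≤ ((1 + Real.log Q) * (1 + Real.log R)) ^ κ₁ :=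
            pow_le_pow_left₀ (by linarith) (by nlinarith) _
        _ ≤ ((1 + Real.log Q) * (1 + Real.log R)) ^ max κ₁ κ₂ :=
            pow_le_pow_right₀ hΛ1 (le_max_left _ _)
    calc C₁ * (σ 0 e : ℝ) ^ 2 * (Q : ℝ) ^ 2 * (1 + Real.log Q) ^ κ₁
        = C₁ * ((σ 0 e : ℝ) ^ 2 * (Q : ℝ) ^ 2) * (1 + Real.log Q) ^ κ₁ := by ring
      _ ≤ max C₁ C₂ * ((σ 0 e : ℝ) ^ 2 * (Q : ℝ) ^ 2) *
          ((1 + Real.log Q) * (1 + Real.log R)) ^ max κ₁ κ₂ :=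
          mul_le_mul (mul_le_mul_of_nonneg_right (le_max_left C₁ C₂) (by positivity)) e1
            (by positivity) (mul_nonneg (hC₁.le.trans (le_max_left C₁ C₂)) (by positivity))
  have hB : LHS ≤ max C₁ C₂ * ((Q : ℝ) * R + (R : ℝ) ^ 3) *
      ((1 + Real.log Q) * (1 + Real.log R)) ^ max κ₁ κ₂ := by
    refine le_trans (sum_le_sum_of_subset_of_nonneg (filter_subset _ _) fun _ _ _ => sq_nonneg _)
      ((h₂ e Q R).trans ?_)
    exact mul_le_mul (mul_le_mul_of_nonneg_right (le_max_right C₁ C₂) (by positivity))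
      (pow_le_pow_right₀ hΛ1 (le_max_right κ₁ κ₂)) (by positivity)
      (mul_nonneg (hC₂.le.trans (le_max_right C₁ C₂)) (by positivity))
  rcases le_total ((σ 0 e : ℝ) ^ 2 * (Q : ℝ) ^ 2) ((Q : ℝ) * R + (R : ℝ) ^ 3) with h | h
  · rw [min_eq_left h]; exact hA
  · rw [min_eq_right h]; exact hB

end Literature.NumberTheory.Sieve.FriedlanderIwaniecPrimes
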